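import Summits.AnomalousDissipation.AnomalousDissipation.Theorems.ScalarAnomalySteadySourceFormal.Negative.ShearFlux
import Summits.AnomalousDissipation.AnomalousDissipation.Theorems.ScalarAnomalySteadySourceFormal.Negative.RestFlowSteady
import Summits.AnomalousDissipation.AnomalousDissipation.Theorems.ScalarAnomalySteadySourceFormal.Negative.DriftCore

/-!
# Negative knowledge for the crux `ScalarAnomalySteadySourceFormal` (stmt-AnomalousDissipation-0448), VII-e:
# the band inequality transported back to the weak solution

Certified copy of §9.5 of the cdisprove work file.  The band dissipation inequality of
`Negative.ShearBand` (stated along the continuous representatives `ỹ`) is rewritten along the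
actual modes `y_p(t) = 𝓕θ(t)(p)` of the weak solution (they agree for a.e. `t`), and its right-hand
side is bounded by quantities of the solution itself: Bessel (`∑_{p∈F} ‖y_p(t)‖² ≤ ‖θ(t)‖²`), the
boundary-flux bound of `Negative.ShearFlux` and Cauchy–Schwarz for the source pairing.  Result
(`band_modes_le`): for the band `𝔅 = box K' K₂' \\ box K K₂`,
`2ν ∫₀ᵀ bandDiss 𝔅 y ≤ ‖θ₀‖² + 4π #S M (K₂ ∫₀ᵀ innerLayerSum + K₂' ∫₀ᵀ outerLayerSum) + 2 η_𝔅 ∫₀ᵀ ‖θ(t)‖`.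
Also the slice toolkit (`forced_ae_scalarL2Sq_le`, integrability of `‖θ(t)‖²`, `‖θ(t)‖`, `‖y_p(t)‖²`).

Supports stmt-AnomalousDissipation-0448 (the shear–drift no-go, files `Shear*`).
-/

set_option linter.dupNamespace false

noncomputable section

open scoped BigOperators Topology ENNReal NNReal InnerProductSpace ContDiff
open Filter Set Function MeasureTheory UnitAddTorus Complex

namespace Summit.AnomalousDissipation.AnomalousDissipation.Theorems.ScalarAnomalySteadySourceFormal.Negative

open Literature.Analysis
open Literature.Analysis.FunctionSpaces Literature.Analysis.FunctionSpaces.Torus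
open Literature.Analysis.FluidPDE Literature.Analysis.FluidPDE.Torus

section SliceToolkit

variable {d : Type*} [Fintype d]
variable {T κ : ℝ} {u : ℝ → UnitAddTorus d → EuclideanSpace ℝ d} {s : ℝ → UnitAddTorus d → ℝ}
  {θ₀ : UnitAddTorus d → ℝ} {θ : ℝ → UnitAddTorus d → ℝ}

/-- **`L^∞_t L²_x` in real form**: `‖θ(t)‖² ≤ C` for a.e. `t ∈ (0,T)` (forced class). [folklore] -/
theorem forced_ae_scalarL2Sq_le (hw : IsWeakScalarTransportForcedOn T κ u s θ₀ θ) :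
    ∃ C : ℝ, 0 ≤ C ∧ ∀ᵐ t ∂(volume.restrict (Ioo 0 T)), scalarL2Sq (θ t) ≤ C := by
  obtain ⟨C, hC⟩ := hw.ae_lintegral_sq_le
  refine ⟨(C : ℝ≥0∞).toReal, ENNReal.toReal_nonneg, ?_⟩
  filter_upwards [hC, forced_ae_memLp_two hw] with t ht hm
  rw [scalarL2Sq, integral_sq_eq_toReal_lintegral hm]
  exact ENNReal.toReal_mono ENNReal.coe_ne_top ht

/-- `t ↦ ‖θ(t)‖²` is integrable on `(0,T)` (forced class). [folklore] -/
theorem forced_integrableOn_scalarL2Sq (hw : IsWeakScalarTransportForcedOn T κ u s θ₀ θ) :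
    IntegrableOn (fun t => scalarL2Sq (θ t)) (Ioo 0 T) volume := by
  obtain ⟨C, _, hC⟩ := forced_ae_scalarL2Sq_le hw
  refine IntegrableOn.of_bound measure_Ioo_lt_top (aestronglyMeasurable_scalarL2Sq hw) C ?_
  filter_upwards [hC] with t ht
  rw [Real.norm_eq_abs, abs_of_nonneg (scalarL2Sq_nonneg _)]
  exact ht

/-- `t ↦ ‖θ(t)‖ = √‖θ(t)‖²` is integrable on `(0,T)` (forced class). [folklore] -/
theorem forced_integrableOn_sqrt_scalarL2Sq (hw : IsWeakScalarTransportForcedOn T κ u s θ₀ θ) :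
    IntegrableOn (fun t => Real.sqrt (scalarL2Sq (θ t))) (Ioo 0 T) volume := by
  obtain ⟨C, hC0, hC⟩ := forced_ae_scalarL2Sq_le hw
  refine IntegrableOn.of_bound measure_Ioo_lt_top
    (Real.continuous_sqrt.comp_aestronglyMeasurable (aestronglyMeasurable_scalarL2Sq hw)) (Real.sqrt C) ?_
  filter_upwards [hC] with t ht
  rw [Real.norm_eq_abs, abs_of_nonneg (Real.sqrt_nonneg _)]
  exact Real.sqrt_le_sqrt ht

/-- **Bessel along the solution**: `∑_{p∈F} ‖y_p(t)‖² ≤ ‖θ(t)‖²` for a.e. `t ∈ (0,T)`. [folklore] -/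
theorem forced_ae_sum_sq_modes_le (hw : IsWeakScalarTransportForcedOn T κ u s θ₀ θ) (F : Finset (d → ℤ)) :
    ∀ᵐ t ∂(volume.restrict (Ioo 0 T)), ∑ p ∈ F, ‖modes θ t p‖ ^ 2 ≤ scalarL2Sq (θ t) := by
  filter_upwards [forced_ae_memLp_two hw] with t ht
  exact sum_sq_norm_mFourierCoeff_le_integral_sq ht F

/-- `t ↦ ‖y_p(t)‖²` is integrable on `(0,T)` (forced class). [folklore] -/
theorem forced_integrableOn_sq_modes (hw : IsWeakScalarTransportForcedOn T κ u s θ₀ θ) (p : d → ℤ) :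
    IntegrableOn (fun t => ‖modes θ t p‖ ^ 2) (Ioo 0 T) volume := by
  obtain ⟨C, hC0, hC⟩ := forced_ae_scalarL2Sq_le hw
  refine IntegrableOn.of_bound measure_Ioo_lt_top
    (((forced_integrableOn_mFourierCoeff hw p).aestronglyMeasurable.norm).pow 2) C ?_
  filter_upwards [hC, forced_ae_sum_sq_modes_le hw {p}] with t ht hB
  rw [Finset.sum_singleton] at hB
  rw [Real.norm_eq_abs, abs_of_nonneg (sq_nonneg _)]
  exact hB.trans ht

/-- Finite weighted sums of `‖y_p(t)‖²` are integrable on `(0,T)`. [folklore] -/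
theorem forced_integrableOn_sum_sq_modes (hw : IsWeakScalarTransportForcedOn T κ u s θ₀ θ) (F : Finset (d → ℤ))
    (w : (d → ℤ) → ℝ) :
    IntegrableOn (fun t => ∑ p ∈ F, w p * ‖modes θ t p‖ ^ 2) (Ioo 0 T) volume :=
  integrable_finsetSum _ fun p _ => (forced_integrableOn_sq_modes hw p).const_mul _

end SliceToolkit

section Transport

variable {d : Type*} [Fintype d]
variable {ν : ℝ} {S : Finset (d → ℤ)} {c : ℝ → (d → ℤ) → EuclideanSpace ℂ d}
  {u : ℝ → UnitAddTorus d → EuclideanSpace ℝ d} {h θ₀ : UnitAddTorus d → ℝ} {θ : ℝ → UnitAddTorus d → ℝ}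

/-- **From representatives back to the solution**: interval integrals of any functional of the
mode vector agree, `∫₀ᵀ Φ(ỹ(t)) dt = ∫_{(0,T)} Φ(y(t)) dt`. [folklore] -/
theorem intervalIntegral_cmodes_eq (hw : IsWeakScalarTransportForced ν u (fun _ => h) θ₀ θ)
    (hu : ∀ s, u s = realTrigPoly S (c s)) (hh : Integrable h volume) (hθ₀ : Integrable θ₀ volume)
    {T : ℝ} (hT : 0 < T) (Φ : ℝ → ((d → ℤ) → ℂ) → ℝ) :
    ∫ t in (0 : ℝ)..T, Φ t (cmodes ν S c h θ₀ θ t) = ∫ t in Ioo 0 T, Φ t (modes θ t) := by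
  rw [intervalIntegral.integral_of_le hT.le, integral_Ioc_eq_integral_Ioo]
  refine setIntegral_congr_ae measurableSet_Ioo ?_
  have hae := ae_modes_eq_cmodes hw hu hh hθ₀ hT
  filter_upwards [(ae_restrict_iff' measurableSet_Ioo).1 hae] with t ht htI
  rw [show modes θ t = cmodes ν S c h θ₀ θ t from funext (ht htI)]

/-- A function of time that agrees a.e. on `(0,T)` with a function continuous on `[0,T]` is
integrable on `(0,T)`. [folklore] -/
theorem integrableOn_of_ae_eq_continuousOn {T : ℝ} {f g : ℝ → ℝ} (hg : ContinuousOn g (Icc 0 T))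
    (hfg : ∀ᵐ t ∂(volume.restrict (Ioo 0 T)), f t = g t) : IntegrableOn f (Ioo 0 T) volume := by
  have hgI : IntegrableOn g (Ioo 0 T) volume :=
    (hg.integrableOn_compact isCompact_Icc).mono_set Ioo_subset_Icc_self
  exact hgI.congr_fun_ae (EventuallyEq.symm hfg)

/-- The modes-version of a functional continuous along the representatives is integrable. [folklore] -/
theorem integrableOn_comp_modes (hw : IsWeakScalarTransportForced ν u (fun _ => h) θ₀ θ)
    (hu : ∀ s, u s = realTrigPoly S (c s)) (hh : Integrable h volume) (hθ₀ : Integrable θ₀ volume)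
    {T : ℝ} (hT : 0 < T) (Φ : ℝ → ((d → ℤ) → ℂ) → ℝ)
    (hΦ : ContinuousOn (fun t => Φ t (cmodes ν S c h θ₀ θ t)) (Icc 0 T)) :
    IntegrableOn (fun t => Φ t (modes θ t)) (Ioo 0 T) volume := by
  refine integrableOn_of_ae_eq_continuousOn hΦ ?_
  filter_upwards [ae_modes_eq_cmodes hw hu hh hθ₀ hT] with t ht
  rw [show modes θ t = cmodes ν S c h θ₀ θ t from funext ht]

end Transport

section BandModes

/-- The frequency lattice `ℤ²` (local notation). -/
local notation "ℤ²" => Fin 2 → ℤ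

variable {ν : ℝ} {S : Finset ℤ²} {R : ℕ} {M : ℝ} {c : ℝ → ℤ² → EuclideanSpace ℂ (Fin 2)}
  {u : ℝ → UnitAddTorus (Fin 2) → EuclideanSpace ℝ (Fin 2)} {h θ₀ : UnitAddTorus (Fin 2) → ℝ}
  {θ : ℝ → UnitAddTorus (Fin 2) → ℝ}

/-- The `ℓ²` mass of the source modes on a finite set: `η_𝔅 = (∑_{p∈𝔅} ‖𝓕h(p)‖²)^{1/2}`. [folklore] -/
def sourceMass (𝔅 : Finset ℤ²) (h : UnitAddTorus (Fin 2) → ℝ) : ℝ :=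
  Real.sqrt (∑ p ∈ 𝔅, ‖mFourierCoeff (fun x => (h x : ℂ)) p‖ ^ 2)

/-- `sourceMass ≥ 0`. [folklore] -/
theorem sourceMass_nonneg (𝔅 : Finset ℤ²) (h : UnitAddTorus (Fin 2) → ℝ) : 0 ≤ sourceMass 𝔅 h :=
  Real.sqrt_nonneg _

/-- **The band inequality along the weak solution.**  For the band `𝔅 = box K' K₂' \\ box K K₂`
and every `T > 0`:
`2ν ∫_{(0,T)} bandDiss 𝔅 y ≤ ‖θ₀‖² + 4π #S M (K₂ ∫ innerLayerSum y + K₂' ∫ outerLayerSum y) + 2 η_𝔅 ∫ ‖θ(t)‖`. [folklore] -/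
theorem band_modes_le (hw : IsWeakScalarTransportForced ν u (fun _ => h) θ₀ θ)
    (hu : ∀ s, u s = realTrigPoly S (c s)) (hh : Integrable h volume) (hθ₀ : MemLp θ₀ 2 volume)
    (hc : ∀ k, Continuous fun s => c s k) (hM : ∀ s k, ‖c s k‖ ≤ M) (hM0 : 0 ≤ M)
    (htrans : ∀ s, ∀ k ∈ S, zdot k (c s k) = 0) (hS : ∀ k ∈ S, k 1 = 0 ∧ |k 0| ≤ R)
    {K K₂ K' K₂' : ℤ} (hK₂ : 0 ≤ K₂) (hK₂' : 0 ≤ K₂') {T : ℝ} (hT : 0 < T) :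
    2 * ν * ∫ t in Ioo 0 T, bandDiss (box K' K₂' \ box K K₂) (modes θ t) ≤
      scalarL2Sq θ₀ +
        4 * Real.pi * S.card * M * (K₂ * (∫ t in Ioo 0 T, layerSum (K - R) (K + R) K₂ (modes θ t)) +
          K₂' * ∫ t in Ioo 0 T, layerSum (K' - R) (K' + R) K₂' (modes θ t)) +
        2 * sourceMass (box K' K₂' \ box K K₂) h * ∫ t in Ioo 0 T, Real.sqrt (scalarL2Sq (θ t)) := by
  classical
  set 𝔅 := box K' K₂' \ box K K₂ with h𝔅
  have hθ₀i : Integrable θ₀ volume := hθ₀.integrable one_le_two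
  have hband := band_dissipation_le hw hu hh hθ₀i hc hM htrans hT 𝔅
  -- convert the three interval integrals
  rw [intervalIntegral_cmodes_eq hw hu hh hθ₀i hT (fun _ Y => bandDiss 𝔅 Y),
    intervalIntegral_cmodes_eq hw hu hh hθ₀i hT (fun t Y => ‖bdryFlux S 𝔅 (c t) Y‖),
    intervalIntegral_cmodes_eq hw hu hh hθ₀i hT (fun _ Y => ‖sourcePairing 𝔅 h Y‖)] at hband
  -- (1) datum: Bessel
  have h0 : bandEnergy 𝔅 (fun p => mFourierCoeff (fun x => (θ₀ x : ℂ)) p) ≤ scalarL2Sq θ₀ :=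
    sum_sq_norm_mFourierCoeff_le_integral_sq hθ₀ 𝔅
  -- (2) flux
  have hwT := hw T hT
  have hflux : ∫ t in Ioo 0 T, ‖bdryFlux S 𝔅 (c t) (modes θ t)‖ ≤
      2 * S.card * M * (K₂ * (∫ t in Ioo 0 T, layerSum (K - R) (K + R) K₂ (modes θ t)) +
        K₂' * ∫ t in Ioo 0 T, layerSum (K' - R) (K' + R) K₂' (modes θ t)) := by
    have hiG : IntegrableOn (fun t => layerSum (K - R) (K + R) K₂ (modes θ t)) (Ioo 0 T) volume := by
      simpa [layerSum] using forced_integrableOn_sum_sq_modes hwT (layer (K - R) (K + R) K₂) (fun _ => 1)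
    have hiO : IntegrableOn (fun t => layerSum (K' - R) (K' + R) K₂' (modes θ t)) (Ioo 0 T) volume := by
      simpa [layerSum] using forced_integrableOn_sum_sq_modes hwT (layer (K' - R) (K' + R) K₂') (fun _ => 1)
    have hiF : IntegrableOn (fun t => ‖bdryFlux S 𝔅 (c t) (modes θ t)‖) (Ioo 0 T) volume :=
      integrableOn_comp_modes hw hu hh hθ₀i hT (fun t Y => ‖bdryFlux S 𝔅 (c t) Y‖)
        (continuousOn_bdryFlux hw hc hM hT 𝔅).norm
    calc ∫ t in Ioo 0 T, ‖bdryFlux S 𝔅 (c t) (modes θ t)‖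
        ≤ ∫ t in Ioo 0 T, 2 * S.card * M * (K₂ * layerSum (K - R) (K + R) K₂ (modes θ t) +
            K₂' * layerSum (K' - R) (K' + R) K₂' (modes θ t)) := by
          refine integral_mono_ae hiF (((hiG.const_mul _).add (hiO.const_mul _)).const_mul _)
            (Eventually.of_forall fun t => ?_)
          exact norm_bdryFlux_band_le hK₂ hK₂' hS (htrans t) (hM t) hM0 (modes θ t)
      _ = 2 * S.card * M * (K₂ * (∫ t in Ioo 0 T, layerSum (K - R) (K + R) K₂ (modes θ t)) +
            K₂' * ∫ t in Ioo 0 T, layerSum (K' - R) (K' + R) K₂' (modes θ t)) := by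
          rw [integral_const_mul, integral_add (hiG.const_mul _) (hiO.const_mul _), integral_const_mul,
            integral_const_mul]
  -- (3) source
  have hsrc : ∫ t in Ioo 0 T, ‖sourcePairing 𝔅 h (modes θ t)‖ ≤
      sourceMass 𝔅 h * ∫ t in Ioo 0 T, Real.sqrt (scalarL2Sq (θ t)) := by
    have hiP : IntegrableOn (fun t => ‖sourcePairing 𝔅 h (modes θ t)‖) (Ioo 0 T) volume :=
      integrableOn_comp_modes hw hu hh hθ₀i hT (fun _ Y => ‖sourcePairing 𝔅 h Y‖)
        (continuousOn_sourcePairing hw hc hM hT 𝔅).norm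
    rw [← integral_const_mul]
    refine integral_mono_ae hiP ((forced_integrableOn_sqrt_scalarL2Sq hwT).const_mul _) ?_
    filter_upwards [forced_ae_sum_sq_modes_le hwT 𝔅] with t ht
    refine (norm_sourcePairing_le 𝔅 h (modes θ t)).trans ?_
    exact mul_le_mul_of_nonneg_left (Real.sqrt_le_sqrt ht) (sourceMass_nonneg _ _)
  have hπ := Real.pi_pos
  have hsm := sourceMass_nonneg 𝔅 h
  calc 2 * ν * ∫ t in Ioo 0 T, bandDiss 𝔅 (modes θ t)
      ≤ bandEnergy 𝔅 (fun p => mFourierCoeff (fun x => (θ₀ x : ℂ)) p) +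
          2 * Real.pi * (∫ t in Ioo 0 T, ‖bdryFlux S 𝔅 (c t) (modes θ t)‖) +
          2 * ∫ t in Ioo 0 T, ‖sourcePairing 𝔅 h (modes θ t)‖ := hband
    _ ≤ scalarL2Sq θ₀ + 2 * Real.pi * (2 * S.card * M * (K₂ * (∫ t in Ioo 0 T, layerSum (K - R) (K + R) K₂ (modes θ t)) +
          K₂' * ∫ t in Ioo 0 T, layerSum (K' - R) (K' + R) K₂' (modes θ t))) +
          2 * (sourceMass 𝔅 h * ∫ t in Ioo 0 T, Real.sqrt (scalarL2Sq (θ t))) := by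
        gcongr
    _ = _ := by ring

/-- `∫_{(0,T)} bandDiss 𝔅 y = ∑_{p∈𝔅} 4π²|p|² ∫_{(0,T)} ‖y_p‖²` (finite sum out of the integral). [folklore] -/
theorem integral_bandDiss_eq (hw : IsWeakScalarTransportForced ν u (fun _ => h) θ₀ θ) {T : ℝ} (hT : 0 < T)
    (𝔅 : Finset ℤ²) :
    ∫ t in Ioo 0 T, bandDiss 𝔅 (modes θ t) =
      ∑ p ∈ 𝔅, 4 * Real.pi ^ 2 * freqNormSq p * ∫ t in Ioo 0 T, ‖modes θ t p‖ ^ 2 := by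
  unfold bandDiss
  rw [integral_finsetSum _ fun p _ => (forced_integrableOn_sq_modes (hw T hT) p).const_mul _]
  refine Finset.sum_congr rfl fun p _ => ?_
  rw [integral_const_mul]

end BandModes

end Summit.AnomalousDissipation.AnomalousDissipation.Theorems.ScalarAnomalySteadySourceFormal.Negative
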